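import Summits.AtomisticToContinuum.FouriersLaw.Theorems.BondHeatUncertaintySubdiffusiveBondHeatJunctionSplitLaw

/-!
# `JunctionDefectGrading` — file 6: the RELATIVE split law and a FLOOR-FREE multiplicative kernel
# (cell `decomp-a2c`, lens-1 «grading / quantitative ladder», gen 57; companion of file 5; imports only file 3)

The memo's estimate (I) «interface thermalisation» is a RELATIVE error: `r_N ≥ (1 − ε)·(r_u + r_v)` across a sacrificed buffer, `ε = K·N^{−α}`
(`α = a·β` for an interface error `K·L^{−a}` over a buffer `L ≍ N^β`).  Converting it into file 3's ABSOLUTE defect `C·N^θ` needs an upper bound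
`r_u ≤ C·u`, i.e. the OPEN aside `ConductanceFloor` (REP 24581) — `splitLaw_of_relativeSplitLaw_of_conductanceFloor` below types exactly that
bookkeeping (`θ = 1 − α`).  The point of this file: the conversion is unnecessary.  A relative law with a SCALE-SUMMABLE error closes 11071 on its
own, for EVERY rate `α > 0`, with no exponent floor beyond the free `r_N ≥ 1` (`E_N ≤ 1`, tree):
* KERNEL `linear_of_relativeSplit` (pure sequence analysis, the multiplicative analogue of file 3's kernel / of the de Bruijn–Erdős–Hammersley
  summable-error subadditive lemma): balanced splits with buffer `≤ K·N^{1−α}` and `(1 − K·N^{−α})(r_u + r_v) ≤ r_N`, plus `r_N ≥ ρ > 0`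
  eventually, give `a·N ≤ r_N` eventually.  Inductive minorant `m·N + m·D·N^{1−α}` (`D = 8K/(g−1)`, `g = (3/2)^α`): every loss is PROPORTIONAL
  to the rate `m`, so the seed window `[N₀, 3N₀)` needs only positivity — this is why no floor/trade appears (contrast file 3: absolute defect
  `C·N^θ` ⟹ floor `s > θ` needed and sharp).
* PIECE `RelativeSplitLaw α` and FRAME `boundedResponse_of_relativeSplitLaw : 0 < α → RelativeSplitLaw α → BoundedResponse` (11071 BY NAME).
* DICTIONARY: `BufferedSeriesLaw ⟹ RelativeSplitLaw α` (`α ≤ 1`); `SplitLaw θ`, `θ < 0` ⟹ `RelativeSplitLaw (min (−θ) (1−b))` is NOT typed (needs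
  the buffer exponent; remark only); `RelativeSplitLaw α ∧ ConductanceFloor ⟹ SplitLaw (1 − α)` (the memo's `θ = 1 − aβ`, honest: it consumes
  the open aside).  Calibration: the relative shape FAILS for bounded `r` and for `r_N = N/log N` (it has Fourier content alone — unlike every
  absolute-defect shape with `θ ≥ 0`), and HOLDS for `r_N ≍ N` with a power-law approach; so `RelativeSplitLaw α` is a costume-free STRENGTHENING
  of nothing in the tree and a WEAKENING of «Fourier with rate»: UNDECIDED · IDEA-NEEDED · INSTRUMENTABLE (census ratio `r_N/(r_u + r_v)` vs `N`).
No `sorry`; standard axioms.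
-/

noncomputable section

open Set

namespace Summit.AtomisticToContinuum.FouriersLaw.Theorems.SubdiffusiveBondHeat

namespace JunctionDefectGrading

open Summit.AtomisticToContinuum.FouriersLaw.Theses.BondHeatUncertainty (BoundedResponse)
open Summit.AtomisticToContinuum.FouriersLaw.Theorems.SubdiffusiveBondHeat.EscapeGrading
  (escapeDeficit OhmicFloor ohmicFloor_iff_boundedResponse ExponentFloor)

/-! ## A. The multiplicative kernel (pure sequence analysis) -/

/-- **THE FLOOR-FREE KERNEL — relative error, balanced split with a sacrificed buffer.**  If for every large `N` SOME decomposition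
`N = u + L + v` has both parts in the middle third (`N ≤ 3u`, `N ≤ 3v`), buffer `L ≤ K·N^{1−α}` and `(1 − K·N^{−α})·(r_u + r_v) ≤ r_N`
(`α > 0`, `K ≥ 0`), and `ρ ≤ r_N` eventually for some `ρ > 0`, then `a·N ≤ r_N` eventually, some `a > 0`.  Inductive minorant
`m·N + B·N^{1−α}` with `B = m·D`, `D = 8K/(g−1)`, `g = (2/3)^{−α} > 1`; thresholds `2gK/(g−1) ≤ N₀^α` (second-order loss of the gain step) and
`K·(3g+5)/(2(g−1)) ≤ N₀^α` (relative loss `K·N^{−α} ≤ τ = 2(g−1)/(3g+5)`); rate `m = ρ/(3(1+D)N₀)` from the seed window alone. [kernel] -/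
theorem linear_of_relativeSplit {r : ℕ → ℝ} {α K ρ : ℝ} {N₁ N₂ : ℕ} (hα : 0 < α) (hK : 0 ≤ K) (hρ : 0 < ρ)
    (hR : ∀ N : ℕ, N₂ ≤ N → ∃ u v : ℕ, N ≤ 3 * u ∧ N ≤ 3 * v ∧ u + v ≤ N ∧
      (N : ℝ) - u - v ≤ K * (N : ℝ) ^ (1 - α) ∧ (1 - K * (N : ℝ) ^ (-α)) * (r u + r v) ≤ r N)
    (hF : ∀ N : ℕ, N₁ ≤ N → ρ ≤ r N) :
    ∃ a : ℝ, 0 < a ∧ ∃ N₀ : ℕ, ∀ N : ℕ, N₀ ≤ N → a * (N : ℝ) ≤ r N := by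
  -- (1) exponent `e = 1 − α`, gain `g = (2/3)^{e−1} > 1`, correction budget `D = 8K/(g−1)` per unit rate
  obtain ⟨e, he⟩ : ∃ e : ℝ, e = 1 - α := ⟨_, rfl⟩
  have he1 : e ≤ 1 := by rw [he]; linarith
  have heα : e - 1 = -α := by rw [he]; ring
  obtain ⟨g, hg⟩ : ∃ g : ℝ, g = (2 / 3 : ℝ) ^ (e - 1) := ⟨_, rfl⟩
  have hg1 : 1 < g := by
    rw [hg, Real.one_lt_rpow_iff_of_pos (by norm_num : (0 : ℝ) < 2 / 3)]
    exact Or.inr ⟨by norm_num, by linarith⟩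
  have hg0 : 0 < g := by linarith
  have hgne : g - 1 ≠ 0 := by intro h; linarith
  obtain ⟨D, hD⟩ : ∃ D : ℝ, D = 8 * K / (g - 1) := ⟨_, rfl⟩
  have hD0 : 0 ≤ D := by rw [hD]; exact div_nonneg (by positivity) (by linarith)
  have hDg : D * (g - 1) = 8 * K := by rw [hD]; exact div_mul_cancel₀ (8 * K) hgne
  -- (2) thresholds
  obtain ⟨M, hM⟩ : ∃ M : ℝ, M = 2 * g * K / (g - 1) := ⟨_, rfl⟩
  have hM0 : 0 ≤ M := by rw [hM]; exact div_nonneg (by positivity) (by linarith)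
  have hMg : (g - 1) / 2 * M = g * K := by rw [hM]; field_simp
  obtain ⟨τ, hτ⟩ : ∃ τ : ℝ, τ = 2 * (g - 1) / (3 * g + 5) := ⟨_, rfl⟩
  have hτ0 : 0 < τ := by rw [hτ]; exact div_pos (by linarith) (by linarith)
  have hτD : τ * (D + 3 * K) = 2 * K := by
    rw [hτ, hD]
    field_simp
    ring
  obtain ⟨M₂, hM₂⟩ : ∃ M₂ : ℝ, M₂ = K / τ := ⟨_, rfl⟩
  have hM₂0 : 0 ≤ M₂ := by rw [hM₂]; exact div_nonneg hK hτ0.le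
  have hτM₂ : τ * M₂ = K := by rw [hM₂]; field_simp
  obtain ⟨Nm, hNm⟩ := exists_nat_ge (M ^ (1 / α))
  obtain ⟨Nt, hNt⟩ := exists_nat_ge (M₂ ^ (1 / α))
  obtain ⟨N₀, hN₀1, hN₀2, hN₀two, hN₀m, hN₀t⟩ :
      ∃ N₀ : ℕ, N₁ ≤ N₀ ∧ N₂ ≤ N₀ ∧ 2 ≤ N₀ ∧ Nm ≤ N₀ ∧ Nt ≤ N₀ :=
    ⟨N₁ + N₂ + 2 + Nm + Nt, by omega, by omega, by omega, by omega, by omega⟩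
  have hN₀pos : (0 : ℝ) < N₀ := by exact_mod_cast lt_of_lt_of_le (by norm_num) hN₀two
  have rpow_thresh : ∀ {X : ℝ} {Nx : ℕ}, 0 ≤ X → X ^ (1 / α) ≤ (Nx : ℝ) → Nx ≤ N₀ → X ≤ (N₀ : ℝ) ^ α := by
    intro X Nx hX hNx hle
    have h1 : X ^ (1 / α) ≤ (N₀ : ℝ) := le_trans hNx (by exact_mod_cast hle)
    have h2 : (X ^ (1 / α)) ^ α ≤ (N₀ : ℝ) ^ α := Real.rpow_le_rpow (Real.rpow_nonneg hX _) h1 hα.le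
    have h3 : (X ^ (1 / α)) ^ α = X := by rw [← Real.rpow_mul hX, one_div_mul_cancel hα.ne', Real.rpow_one]
    rwa [h3] at h2
  have hN₀M : M ≤ (N₀ : ℝ) ^ α := rpow_thresh hM0 hNm hN₀m
  have hN₀M₂ : M₂ ≤ (N₀ : ℝ) ^ α := rpow_thresh hM₂0 hNt hN₀t
  have hP : 0 < (N₀ : ℝ) ^ α := Real.rpow_pos_of_pos hN₀pos _
  -- second-order loss of the gain step beyond `N₀`: `g·K·N^{e−1} ≤ (g−1)/2`
  have hloss : ∀ N : ℕ, N₀ ≤ N → g * K * (N : ℝ) ^ (e - 1) ≤ (g - 1) / 2 := by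
    intro N hN
    have hgK : g * K ≤ (g - 1) / 2 * (N₀ : ℝ) ^ α := by
      rw [← hMg]
      exact mul_le_mul_of_nonneg_left hN₀M (by linarith)
    have h0 : g * K * (N₀ : ℝ) ^ (e - 1) ≤ (g - 1) / 2 := by
      rw [heα, Real.rpow_neg hN₀pos.le, ← div_eq_mul_inv, div_le_iff₀ hP]
      exact hgK
    have hanti : (N : ℝ) ^ (e - 1) ≤ (N₀ : ℝ) ^ (e - 1) :=
      Real.rpow_le_rpow_of_nonpos hN₀pos (by exact_mod_cast hN) (by rw [heα]; linarith)
    exact le_trans (mul_le_mul_of_nonneg_left hanti (mul_nonneg hg0.le hK)) h0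
  -- relative loss beyond `N₀`: `K·N^{−α} ≤ τ`
  have herr : ∀ N : ℕ, N₀ ≤ N → K * (N : ℝ) ^ (-α) ≤ τ := by
    intro N hN
    have hKτ : K ≤ τ * (N₀ : ℝ) ^ α := by
      rw [← hτM₂]
      exact mul_le_mul_of_nonneg_left hN₀M₂ hτ0.le
    have h0 : K * (N₀ : ℝ) ^ (-α) ≤ τ := by
      rw [Real.rpow_neg hN₀pos.le, ← div_eq_mul_inv, div_le_iff₀ hP]
      exact hKτ
    have hanti : (N : ℝ) ^ (-α) ≤ (N₀ : ℝ) ^ (-α) :=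
      Real.rpow_le_rpow_of_nonpos hN₀pos (by exact_mod_cast hN) (by linarith)
    exact le_trans (mul_le_mul_of_nonneg_left hanti hK) h0
  -- (3) the linear rate `m = ρ/(3(1+D)N₀)` and the correction budget `B = m·D`
  have hD1 : 0 < 1 + D := by linarith
  obtain ⟨m, hm⟩ : ∃ m : ℝ, m = ρ / (3 * (1 + D) * N₀) := ⟨_, rfl⟩
  have hm0 : 0 < m := by rw [hm]; positivity
  have hm3 : m * (1 + D) * (3 * N₀) = ρ := by
    rw [hm]
    field_simp
  obtain ⟨B, hB⟩ : ∃ B : ℝ, B = m * D := ⟨_, rfl⟩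
  have hB0 : 0 ≤ B := by rw [hB]; exact mul_nonneg hm0.le hD0
  have hBg : B * (g - 1) = 8 * (m * K) := by rw [hB, mul_assoc, hDg]; ring
  have hτB : τ * (B + 3 * (m * K)) = 2 * (m * K) := by
    have e1 : B + 3 * (m * K) = m * (D + 3 * K) := by rw [hB]; ring
    have e2 : τ * (m * (D + 3 * K)) = m * (τ * (D + 3 * K)) := by ring
    rw [e1, e2, hτD]
    ring
  -- (4) the inductive minorant `m·N + B·N^e ≤ r_N` for `N ≥ N₀`
  have key : ∀ N : ℕ, N₀ ≤ N → m * N + B * (N : ℝ) ^ e ≤ r N := by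
    intro N
    refine Nat.strong_induction_on N fun N ih => ?_
    intro hN
    have hN2 : 2 ≤ N := le_trans hN₀two hN
    have hNpos : (0 : ℝ) < N := by exact_mod_cast lt_of_lt_of_le (by norm_num) hN2
    have hN1 : (1 : ℝ) ≤ N := by exact_mod_cast le_trans (by norm_num : 1 ≤ 2) hN2
    have hNe0 : 0 ≤ (N : ℝ) ^ e := Real.rpow_nonneg hNpos.le e
    by_cases hsmall : N < 3 * N₀
    · -- seed window `N₀ ≤ N < 3N₀`: everything from `ρ ≤ r_N`
      have hFN : ρ ≤ r N := hF N (le_trans hN₀1 hN)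
      have hN3 : (N : ℝ) ≤ 3 * N₀ := by exact_mod_cast hsmall.le
      have heN : (N : ℝ) ^ e ≤ N := by
        have h := Real.rpow_le_rpow_of_exponent_le hN1 he1
        rwa [Real.rpow_one] at h
      have hBN : B * (N : ℝ) ^ e ≤ m * D * N := by
        rw [hB]
        exact mul_le_mul_of_nonneg_left heN (mul_nonneg hm0.le hD0)
      have hmN : m * (1 + D) * N ≤ ρ :=
        calc m * (1 + D) * N ≤ m * (1 + D) * (3 * N₀) := mul_le_mul_of_nonneg_left hN3 (by positivity)
          _ = ρ := hm3
      have e0 : m * (1 + D) * (N : ℝ) = m * N + m * D * N := by ring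
      linarith
    · -- a balanced split with buffer, supplied by the hypothesis
      push Not at hsmall
      obtain ⟨u, v, h3u, h3v, huv, hbuf, hRN⟩ := hR N (le_trans hN₀2 hN)
      have hu₀ : N₀ ≤ u := by omega
      have hv₀ : N₀ ≤ v := by omega
      have huN : u < N := by omega
      have hvN : v < N := by omega
      have h3u2 : 3 * u ≤ 2 * N := by omega
      have h3v2 : 3 * v ≤ 2 * N := by omega
      have ihu := ih u huN hu₀
      have ihv := ih v hvN hv₀
      have hupos : (0 : ℝ) < u := by exact_mod_cast lt_of_lt_of_le (by norm_num) (le_trans hN₀two hu₀)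
      have hvpos : (0 : ℝ) < v := by exact_mod_cast lt_of_lt_of_le (by norm_num) (le_trans hN₀two hv₀)
      have hule : (u : ℝ) ≤ 2 / 3 * N := by
        have h1 : 3 * (u : ℝ) ≤ 2 * N := by exact_mod_cast h3u2
        linarith
      have hvle : (v : ℝ) ≤ 2 / 3 * N := by
        have h1 : 3 * (v : ℝ) ≤ 2 * N := by exact_mod_cast h3v2
        linarith
      have hbuf' : (N : ℝ) - u - v ≤ K * (N : ℝ) ^ e := by rw [he]; exact hbuf
      -- gain on the correction exponent `e`
      have hcomb := split_gain_step he1 hNpos hupos hvpos hule hvle hbuf' (by rw [← hg]; exact hloss N hN)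
      rw [← hg] at hcomb
      have hBcomb : B * (g * (N : ℝ) ^ e - (g - 1) / 2 * (N : ℝ) ^ e) ≤ B * ((u : ℝ) ^ e + (v : ℝ) ^ e) :=
        mul_le_mul_of_nonneg_left hcomb hB0
      have hBval : B * (g * (N : ℝ) ^ e - (g - 1) / 2 * (N : ℝ) ^ e) = B * (N : ℝ) ^ e + 4 * (m * K) * (N : ℝ) ^ e := by
        have e2 : B * (g * (N : ℝ) ^ e - (g - 1) / 2 * (N : ℝ) ^ e)
            = B * (N : ℝ) ^ e + (B * (g - 1)) / 2 * (N : ℝ) ^ e := by ring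
        rw [e2, hBg]
        ring
      -- `X := m·N + B·N^e + 3mK·N^e ≤ r_u + r_v`
      have hS : m * N + B * (N : ℝ) ^ e + 3 * (m * K) * (N : ℝ) ^ e ≤ r u + r v := by
        have hmbuf : m * ((N : ℝ) - u - v) ≤ m * (K * (N : ℝ) ^ e) := mul_le_mul_of_nonneg_left hbuf' hm0.le
        have e3 : m * ((N : ℝ) - u - v) = m * N - m * u - m * v := by ring
        have e4 : m * (K * (N : ℝ) ^ e) = (m * K) * (N : ℝ) ^ e := by ring
        linarith [ihu, ihv, hBcomb, hBval, hmbuf, e3, e4]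
      -- multiply by `1 − K·N^{−α} ∈ [1 − τ, 1]`
      have hKN : K * (N : ℝ) ^ (-α) ≤ τ := herr N hN
      have hKN0 : 0 ≤ K * (N : ℝ) ^ (-α) := mul_nonneg hK (Real.rpow_nonneg hNpos.le _)
      have hτ1 : τ < 1 := by
        rw [hτ, div_lt_one (by linarith)]
        linarith
      have hl0 : 0 ≤ 1 - K * (N : ℝ) ^ (-α) := by linarith
      have hlS : (1 - K * (N : ℝ) ^ (-α)) * (m * N + B * (N : ℝ) ^ e + 3 * (m * K) * (N : ℝ) ^ e) ≤ r N :=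
        le_trans (mul_le_mul_of_nonneg_left hS hl0) hRN
      -- the relative losses: `K·N^{−α}·(m·N) = mK·N^e` and `K·N^{−α}·((B + 3mK)·N^e) ≤ τ(B + 3mK)·N^e = 2mK·N^e`
      have hNsplit : (N : ℝ) ^ e = (N : ℝ) ^ (-α) * N := by
        rw [he, show (1 : ℝ) - α = -α + 1 by ring, Real.rpow_add hNpos, Real.rpow_one]
      have hloss1 : K * (N : ℝ) ^ (-α) * (m * N) = (m * K) * (N : ℝ) ^ e := by rw [hNsplit]; ring
      have hloss2 : K * (N : ℝ) ^ (-α) * (B * (N : ℝ) ^ e + 3 * (m * K) * (N : ℝ) ^ e)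
          ≤ τ * (B + 3 * (m * K)) * (N : ℝ) ^ e := by
        have e6 : K * (N : ℝ) ^ (-α) * (B * (N : ℝ) ^ e + 3 * (m * K) * (N : ℝ) ^ e)
            = (K * (N : ℝ) ^ (-α) * (B + 3 * (m * K))) * (N : ℝ) ^ e := by ring
        rw [e6]
        have hB3 : 0 ≤ B + 3 * (m * K) := by positivity
        exact mul_le_mul_of_nonneg_right (mul_le_mul_of_nonneg_right hKN hB3) hNe0
      rw [hτB] at hloss2
      have e5 : (1 - K * (N : ℝ) ^ (-α)) * (m * N + B * (N : ℝ) ^ e + 3 * (m * K) * (N : ℝ) ^ e)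
          = (m * N + B * (N : ℝ) ^ e + 3 * (m * K) * (N : ℝ) ^ e) - K * (N : ℝ) ^ (-α) * (m * N)
            - K * (N : ℝ) ^ (-α) * (B * (N : ℝ) ^ e + 3 * (m * K) * (N : ℝ) ^ e) := by ring
      linarith [hlS, e5, hloss1, hloss2]
  -- (5) conclusion
  refine ⟨m, hm0, N₀, fun N hN => ?_⟩
  have h := key N hN
  have h1 : 0 ≤ B * (N : ℝ) ^ e := mul_nonneg hB0 (Real.rpow_nonneg (Nat.cast_nonneg N) e)
  linarith

/-- Calibration: the relative shape FAILS for bounded positive sequences — it has Fourier content alone (contrast file 1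
`junction_of_bounded`: every absolute-defect shape with `θ ≥ 0` is satisfied by bounded `r`).  For `r ≡ 1`, `α = 1`, ANY `K ≥ 0`:
`(1 − K/N)·2 > 1` once `N ≥ 4K + 4`. [folklore] -/
theorem relativeSplit_fails_const :
    ¬ ∃ K : ℝ, 0 ≤ K ∧ ∃ N₂ : ℕ, ∀ N : ℕ, N₂ ≤ N → ∃ u v : ℕ, N ≤ 3 * u ∧ N ≤ 3 * v ∧ u + v ≤ N ∧
      (N : ℝ) - u - v ≤ K * (N : ℝ) ^ (1 - (1 : ℝ)) ∧ (1 - K * (N : ℝ) ^ (-(1 : ℝ))) * ((1 : ℝ) + 1) ≤ 1 := by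
  rintro ⟨K, hK, N₂, h⟩
  obtain ⟨N, hN⟩ := exists_nat_ge (max (N₂ : ℝ) (4 * K + 4))
  have hN₂ : N₂ ≤ N := by exact_mod_cast le_trans (le_max_left _ _) hN
  have hNK : 4 * K + 4 ≤ (N : ℝ) := le_trans (le_max_right _ _) hN
  have hNpos : (0 : ℝ) < N := by linarith
  obtain ⟨u, v, -, -, -, -, hle⟩ := h N hN₂
  rw [Real.rpow_neg_one] at hle
  have hKN : K * (N : ℝ)⁻¹ ≤ 1 / 4 := by
    rw [← div_eq_mul_inv, div_le_iff₀ hNpos]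
    linarith
  linarith

/-! ## B. The piece and the frame -/

/-- **Relative split law with rate `α`**: `∀ T > 0 ∃ K ≥ 0 ∃ N₂ ∀ N ≥ N₂ ∃ u v` with `N ≤ 3u`, `N ≤ 3v`, `u + v ≤ N`,
`N − u − v ≤ K·N^{1−α}` and `(1 − K·N^{−α})·(1/E_u + 1/E_v) ≤ 1/E_N`: across SOME sacrificed buffer of length `≤ K·N^{1−α}` the chain's escape
resistance is at least `(1 − K·N^{−α})` times the sum of the parts' — the memo's «interface thermalisation» (I) with rate `α = a·β`, typed.
Tags: UNDECIDED · IDEA-NEEDED · INSTRUMENTABLE (census ratio `r_N/(r_u+r_v)`: T = 10 (64,96,64)|224: `1 + 0.9/r_224`-ish ≥ 1 already);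
implies 11071 for EVERY `α > 0` FLOOR-FREE (`boundedResponse_of_relativeSplitLaw`); implied by `BufferedSeriesLaw` (`α ≤ 1`); FAILS for bounded `r`
(`relativeSplit_fails_const`) — so, unlike the absolute-defect rungs, it carries Fourier content alone; smaller `α` = WEAKER
(`relativeSplitLaw_anti`). [piece · rung] -/
def RelativeSplitLaw (α : ℝ) : Prop :=
  ∀ ω₂ lam β γ : ℝ, 0 < ω₂ → 0 < lam → 0 < β → 0 < γ → ∀ T : ℝ, 0 < T →
    ∃ K : ℝ, 0 ≤ K ∧ ∃ N₂ : ℕ, ∀ N : ℕ, N₂ ≤ N → ∃ u v : ℕ, N ≤ 3 * u ∧ N ≤ 3 * v ∧ u + v ≤ N ∧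
      (N : ℝ) - u - v ≤ K * (N : ℝ) ^ (1 - α) ∧
      (1 - K * (N : ℝ) ^ (-α)) * (1 / escapeDeficit ω₂ lam β γ T u + 1 / escapeDeficit ω₂ lam β γ T v)
        ≤ 1 / escapeDeficit ω₂ lam β γ T N

/-- **`RelativeSplitLaw α ⟹ OhmicFloor`** for every `α > 0`: the kernel at each temperature with `ρ = 1` (`1 ≤ 1/E_N` from the tree's `E_N ≤ 1`
and `0 < E_N`). [kernel · frame] -/
theorem ohmicFloor_of_relativeSplitLaw {α : ℝ} (hα : 0 < α) (hR : RelativeSplitLaw α) : OhmicFloor := by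
  intro ω₂ lam β γ hω hl hβ hγ T hT
  obtain ⟨K, hK, N₂, hR'⟩ := hR ω₂ lam β γ hω hl hβ hγ T hT
  have hpos : ∀ N : ℕ, 2 ≤ N → 0 < escapeDeficit ω₂ lam β γ T N := fun N hN =>
    escapeDeficit_pos hω hl hβ hγ hT hN
  have hFr : ∀ N : ℕ, 2 ≤ N → (1 : ℝ) ≤ 1 / escapeDeficit ω₂ lam β γ T N := fun N hN =>
    one_le_one_div (hpos N hN) (escapeDeficit_le_one ω₂ lam β γ hω hl hβ hγ T hT N)
  obtain ⟨a, ha, N₀, hlin⟩ := linear_of_relativeSplit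
    (r := fun N => 1 / escapeDeficit ω₂ lam β γ T N) hα hK zero_lt_one hR' hFr
  refine ⟨1 / a, max N₀ 2, fun N hN => ?_⟩
  have hE := hpos N (le_trans (le_max_right _ _) hN)
  have hNpos : (0 : ℝ) < N := by
    exact_mod_cast lt_of_lt_of_le (by norm_num) (le_trans (le_max_right N₀ 2) hN)
  have h : a * (N : ℝ) ≤ 1 / escapeDeficit ω₂ lam β γ T N := hlin N (le_trans (le_max_left _ _) hN)
  have h' : a * (N : ℝ) * escapeDeficit ω₂ lam β γ T N ≤ 1 := (le_div_iff₀ hE).mp h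
  rw [div_div, le_div_iff₀ (mul_pos ha hNpos)]
  calc escapeDeficit ω₂ lam β γ T N * (a * N) = a * (N : ℝ) * escapeDeficit ω₂ lam β γ T N := by ring
    _ ≤ 1 := h'

/-- **THE FRAME: `RelativeSplitLaw α → BoundedResponse` (11071 BY NAME) for every `α > 0` — no exponent floor, no trade.** [kernel · frame] -/
theorem boundedResponse_of_relativeSplitLaw {α : ℝ} (hα : 0 < α) : RelativeSplitLaw α → BoundedResponse := fun hR =>
  ohmicFloor_iff_boundedResponse.1 (ohmicFloor_of_relativeSplitLaw hα hR)

/-! ## C. Dictionary -/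

/-- Smaller rate = WEAKER law: `α ≤ α' ⟹ RelativeSplitLaw α' ⟹ RelativeSplitLaw α` (for `N ≥ 1`: `N^{−α'} ≤ N^{−α}`, `N^{1−α'} ≤ N^{1−α}`;
the parts' resistances are positive). [folklore] -/
theorem relativeSplitLaw_anti {α α' : ℝ} (hαα' : α ≤ α') : RelativeSplitLaw α' → RelativeSplitLaw α := by
  intro hR ω₂ lam β γ hω hl hβ hγ T hT
  obtain ⟨K, hK, N₂, h⟩ := hR ω₂ lam β γ hω hl hβ hγ T hT
  refine ⟨K, hK, max N₂ 6, fun N hN => ?_⟩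
  obtain ⟨u, v, h3u, h3v, huv, hbuf, hJ⟩ := h N (le_trans (le_max_left _ _) hN)
  have hN6 : 6 ≤ N := le_trans (le_max_right _ _) hN
  have hN1 : (1 : ℝ) ≤ N := by exact_mod_cast (show 1 ≤ N by omega)
  have hEu : 0 < escapeDeficit ω₂ lam β γ T u := escapeDeficit_pos hω hl hβ hγ hT (by omega)
  have hEv : 0 < escapeDeficit ω₂ lam β γ T v := escapeDeficit_pos hω hl hβ hγ hT (by omega)
  have hsum : 0 ≤ 1 / escapeDeficit ω₂ lam β γ T u + 1 / escapeDeficit ω₂ lam β γ T v := by positivity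
  have hmono1 : (N : ℝ) ^ (1 - α') ≤ (N : ℝ) ^ (1 - α) := Real.rpow_le_rpow_of_exponent_le hN1 (by linarith)
  have hmono2 : (N : ℝ) ^ (-α') ≤ (N : ℝ) ^ (-α) := Real.rpow_le_rpow_of_exponent_le hN1 (by linarith)
  refine ⟨u, v, h3u, h3v, huv, le_trans hbuf (mul_le_mul_of_nonneg_left hmono1 hK), le_trans ?_ hJ⟩
  apply mul_le_mul_of_nonneg_right _ hsum
  linarith [mul_le_mul_of_nonneg_left hmono2 hK]

/-- `BufferedSeriesLaw ⟹ RelativeSplitLaw α` for `α ≤ 1` (zero error; fixed buffer `L₀ ≤ L₀·N^{1−α}`; cut `N − L₀` in half). [folklore] -/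
theorem relativeSplitLaw_of_bufferedSeriesLaw {α : ℝ} (hα1 : α ≤ 1) (hB : BufferedSeriesLaw) : RelativeSplitLaw α := by
  intro ω₂ lam β γ hω hl hβ hγ T hT
  obtain ⟨L₀, N₂, h⟩ := hB ω₂ lam β γ hω hl hβ hγ T hT
  refine ⟨L₀, Nat.cast_nonneg L₀, 3 * L₀ + 2 * N₂ + 6, fun N hN => ?_⟩
  have hN1 : (1 : ℝ) ≤ N := by exact_mod_cast (show 1 ≤ N by omega)
  have hNpos : (0 : ℝ) < N := by linarith
  have hu2 : 2 ≤ (N - L₀) / 2 := by omega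
  have hv2 : 2 ≤ N - L₀ - (N - L₀) / 2 := by omega
  have hEu := escapeDeficit_pos hω hl hβ hγ hT hu2
  have hEv := escapeDeficit_pos hω hl hβ hγ hT hv2
  refine ⟨(N - L₀) / 2, N - L₀ - (N - L₀) / 2, by omega, by omega, by omega, ?_, ?_⟩
  · have hsum : (N - L₀) / 2 + (N - L₀ - (N - L₀) / 2) + L₀ = N := by omega
    have hcast : (((N - L₀) / 2 : ℕ) : ℝ) + ((N - L₀ - (N - L₀) / 2 : ℕ) : ℝ) + (L₀ : ℝ) = (N : ℝ) := by exact_mod_cast hsum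
    have hone : (1 : ℝ) ≤ (N : ℝ) ^ (1 - α) := Real.one_le_rpow hN1 (by linarith)
    have hL : (L₀ : ℝ) * 1 ≤ (L₀ : ℝ) * (N : ℝ) ^ (1 - α) := mul_le_mul_of_nonneg_left hone (Nat.cast_nonneg L₀)
    linarith
  · have hle := h ((N - L₀) / 2) (N - L₀ - (N - L₀) / 2) (by omega) (by omega)
    have hsum : (N - L₀) / 2 + L₀ + (N - L₀ - (N - L₀) / 2) = N := by omega
    rw [hsum] at hle
    have hS0 : 0 ≤ 1 / escapeDeficit ω₂ lam β γ T ((N - L₀) / 2) + 1 / escapeDeficit ω₂ lam β γ T (N - L₀ - (N - L₀) / 2) := by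
      positivity
    have hK0 : 0 ≤ (L₀ : ℝ) * (N : ℝ) ^ (-α) := mul_nonneg (Nat.cast_nonneg L₀) (Real.rpow_nonneg hNpos.le _)
    have h1 : (1 - (L₀ : ℝ) * (N : ℝ) ^ (-α))
          * (1 / escapeDeficit ω₂ lam β γ T ((N - L₀) / 2) + 1 / escapeDeficit ω₂ lam β γ T (N - L₀ - (N - L₀) / 2))
        ≤ 1 * (1 / escapeDeficit ω₂ lam β γ T ((N - L₀) / 2) + 1 / escapeDeficit ω₂ lam β γ T (N - L₀ - (N - L₀) / 2)) :=
      mul_le_mul_of_nonneg_right (by linarith) hS0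
    linarith

/-- **The memo's bookkeeping, typed honestly: `RelativeSplitLaw α ∧ ConductanceFloor ⟹ SplitLaw (1 − α)`** (`α > 0`).  The relative error
`K·N^{−α}·(r_u + r_v)` becomes the absolute defect `(K/c)·N^{1−α}` ONLY through the linear upper bound `r_u ≤ u/c` — the OPEN aside
`ConductanceFloor` (REP 24581); and `SplitLaw (1 − α)` then needs a floor `s > 1 − α` (file 3, sharp), whereas `boundedResponse_of_relativeSplitLaw`
needs neither. [this file] -/
theorem splitLaw_of_relativeSplitLaw_of_conductanceFloor {α : ℝ} (hα : 0 < α) (hR : RelativeSplitLaw α) (hC : ConductanceFloor) :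
    SplitLaw (1 - α) := by
  intro ω₂ lam β γ hω hl hβ hγ T hT
  obtain ⟨K, hK, N₂, h⟩ := hR ω₂ lam β γ hω hl hβ hγ T hT
  obtain ⟨c, hc, hfl⟩ := hC ω₂ lam β γ hω hl hβ hγ T hT
  have hKc : 0 ≤ K / c := div_nonneg hK hc.le
  refine ⟨K + K / c, by linarith, 1 - α, by linarith, max N₂ 6, fun N hN => ?_⟩
  obtain ⟨u, v, h3u, h3v, huv, hbuf, hJ⟩ := h N (le_trans (le_max_left _ _) hN)
  have hN6 : 6 ≤ N := le_trans (le_max_right _ _) hN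
  have hNpos : (0 : ℝ) < N := by exact_mod_cast (show 0 < N by omega)
  have hu2 : 2 ≤ u := by omega
  have hv2 : 2 ≤ v := by omega
  set Eu := escapeDeficit ω₂ lam β γ T u with hEu_def
  set Ev := escapeDeficit ω₂ lam β γ T v with hEv_def
  have hEu : 0 < Eu := escapeDeficit_pos hω hl hβ hγ hT hu2
  have hEv : 0 < Ev := escapeDeficit_pos hω hl hβ hγ hT hv2
  -- the linear upper bounds `1/E_u ≤ u/c`, `1/E_v ≤ v/c` from the conductance floor `c ≤ u·E_u`
  have upper : ∀ {w : ℕ} {Ew : ℝ}, 0 < Ew → c ≤ (w : ℝ) * Ew → 1 / Ew ≤ (w : ℝ) / c := by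
    intro w Ew hEw hcw
    rw [le_div_iff₀ hc]
    have h1 : 1 / Ew * c ≤ 1 / Ew * ((w : ℝ) * Ew) := mul_le_mul_of_nonneg_left hcw (by positivity)
    have h2 : 1 / Ew * ((w : ℝ) * Ew) = w := by field_simp
    linarith
  have hru : 1 / Eu ≤ (u : ℝ) / c := upper hEu (hfl u hu2)
  have hrv : 1 / Ev ≤ (v : ℝ) / c := upper hEv (hfl v hv2)
  have hNb : 0 ≤ (N : ℝ) ^ (1 - α) := Real.rpow_nonneg hNpos.le _
  refine ⟨u, v, h3u, h3v, huv, le_trans hbuf (mul_le_mul_of_nonneg_right (by linarith) hNb), ?_⟩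
  have hsumle : 1 / Eu + 1 / Ev ≤ (N : ℝ) / c := by
    have huvR : (u : ℝ) + v ≤ N := by exact_mod_cast huv
    calc 1 / Eu + 1 / Ev ≤ (u : ℝ) / c + (v : ℝ) / c := add_le_add hru hrv
      _ = ((u : ℝ) + v) / c := by ring
      _ ≤ (N : ℝ) / c := div_le_div_of_nonneg_right huvR hc.le
  have hNα0 : 0 ≤ K * (N : ℝ) ^ (-α) := mul_nonneg hK (Real.rpow_nonneg hNpos.le _)
  have hdef : K * (N : ℝ) ^ (-α) * (1 / Eu + 1 / Ev) ≤ K / c * (N : ℝ) ^ (1 - α) :=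
    calc K * (N : ℝ) ^ (-α) * (1 / Eu + 1 / Ev) ≤ K * (N : ℝ) ^ (-α) * ((N : ℝ) / c) :=
          mul_le_mul_of_nonneg_left hsumle hNα0
      _ = K / c * ((N : ℝ) ^ (-α) * N) := by ring
      _ = K / c * (N : ℝ) ^ (1 - α) := by
          rw [show (1 : ℝ) - α = -α + 1 by ring, Real.rpow_add hNpos, Real.rpow_one]
  have e1 : (1 - K * (N : ℝ) ^ (-α)) * (1 / Eu + 1 / Ev) = (1 / Eu + 1 / Ev) - K * (N : ℝ) ^ (-α) * (1 / Eu + 1 / Ev) := by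
    ring
  have e2 : (K + K / c) * (N : ℝ) ^ (1 - α) = K * (N : ℝ) ^ (1 - α) + K / c * (N : ℝ) ^ (1 - α) := by ring
  have hKN : 0 ≤ K * (N : ℝ) ^ (1 - α) := mul_nonneg hK hNb
  linarith [hJ, e1, hdef, hKN, e2]

end JunctionDefectGrading

end Summit.AtomisticToContinuum.FouriersLaw.Theorems.SubdiffusiveBondHeat

end
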